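import Literature.IUT.HodgeArakelov.EtaleThetaDataOfSettingAutActionTop
import Literature.IUT.HodgeArakelov.EtaleThetaDataOfSettingConjStable

/-!
# [IUTchII] Prop 1.4 / 3.4 (i) at the genuine data: `θ(Π)`, `∞θ(Π)` are stable under the Π-intrinsic action of
# `α ∈ Aut_top(Π^tp_X̲̲)` as soon as `α` moves the root class `η̲̈^Θ` into its `(l·ℤ×μ₂)`-orbit up to `μ_l`
# (binder (P4) of Prop 3.4 (i) reduced to [EtTh] Cor 2.19 (iii)-shape at `Π^tp_X̲̲`)

abc-iut cell (WAVE-5 seat abc-iut-w5-d169; holder sub-row «P34i-GENUINE-(P1)» of DAG node IUTchII:Prop3.4(i),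
`plan/L6/SUBDAG-IUTchII-Prop-31-33-34.md`; L6-lead §F v1.19s).  S. Mochizuki, *Inter-universal Teichmüller theory II*,
kurims manuscript (Dec. 2020), Prop. 1.4 p. 27: "a functorial group-theoretic algorithm `Π ↦ θ(Π)` … — cf. the constant
multiple rigidity property of [EtTh], Corollary 2.19, (iii) — for constructing from `Π` the set `θ(Π)` of
`μ_l`-multiples of the reciprocal of the `(l·ℤ×μ_2)`-orbit `η̈^{Θ,l·ℤ×μ_2}` of an `l`-th root of the étale theta function
of standard type"; `∞θ(Π)` ibid.  Claim key `Mochizuki2012` (DISPUTED, D-0012).  [EtTh] (refereed) Cor. 2.19 (iii)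
p. 65 ("an arbitrary automorphism of `Π^tp_{X̲̲}` preserves this collection of classes … [up to] an `l`-th root of
unity"), Cor. 2.18 (i) p. 60 (= F-0620, BY NAME).

WHAT IS PROVED (no `Prop`-valued definition, no named fact; one DATA abbreviation `rootTop`).  Write `ρ^⊤_α` for
abc-iut-w5-d169's top-level intrinsic action `autActTopOfCor218i α` on `H1 ⊤ ≅ H¹(Π^tp_Ÿ̲̲, l·Δ_Θ)`
(`EtaleThetaDataOfSettingAutActionTop.lean`), `ρ_α = autActOfCor218i α` for the limit action, `conj_τ` for
abc-iut-w4-d043's `h1TopConjEquiv τ`, and `η̲̈ := rootTop C` for the class of the chosen `l`-th root (abc-iut-L6-t1 /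
w4-d013 `rootLiftClass`, read in `H1 ⊤`):
* §1 (generic over abc-iut-L6-t1's interface `EtaleThetaData S P`): an additive automorphism moving every orbit member
  into «orbit + `l`-torsion» maps `θ(Π)` into itself (`θ(Π)` IS a union of `l`-torsion cosets of `−orbit`,
  `theta_eq`) — `image_theta_subset_of_orbit_torsion`, `image_theta_eq_of_orbit_torsion`;
* §2 (model): under **`hroot : ∀ α, ∃ τ ε, l•ε = 0 ∧ ρ^⊤_α η̲̈ = conj_τ η̲̈ + ε`** — [EtTh] Cor. 2.19 (iii)'s constant-multiple
  rigidity for a standard-type root, read at `Π^tp_X̲̲` with its printed `(l·ℤ×μ₂)`-indeterminacy (conjugation by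
  `Π^tp_X̲̲ ↠ Π^tp_X̲̲/Π^tp_Ÿ̲̲ ≅ l·ℤ × μ₂`) and `μ_l`-indeterminacy — EVERY `ρ^⊤_α` stabilises the one-root orbit up to
  `l`-torsion (equivariance `ρ^⊤_α ∘ conj_σ = conj_{α σ} ∘ ρ^⊤_α`), hence `θ(Π)` (`image_autActTop_theta_of_rootHyp`),
  hence — compatibility `toLim ⊤ ∘ ρ^⊤_α = ρ_α ∘ toLim ⊤` + abc-iut-w4-d030's `image_toLim_theta_eq_of_compat` /
  `image_thetaInfty_eq_of_compat` — `ρ_α` stabilises `toLim ⊤ '' θ(Π)` and `∞θ(Π)`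
  (`image_autActOfCor218i_toLim_theta_of_rootHyp`, `image_autActOfCor218i_thetaInfty_of_rootHyp`): binder (P4)
  `hθ`/`hinf` of abc-iut-w5-d169's `prop34i_multiradiallyDefined_ofInversion` (p430623) for the genuine record, from `hroot`
  alone (GAP row G-w5d169-2: the exact statement of `hroot`, in-cone = IUTchII:Prop1.4 functoriality clause via
  [EtTh] Cor. 2.19 (iii)).
Nothing here takes a side on [IUTchIII] Cor. 3.12; typed ≠ proved.
-/

noncomputable section

open Topology

namespace Literature.IUT.HodgeArakelov

open Literature.AnabelianGeometry.EtaleTheta (ContH1)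
open Literature.AnabelianGeometry.EtaleTheta CohomologySystemOfContH1

universe u

/-! ### 1. Generic: automorphisms moving the orbit into «orbit + l-torsion» stabilise `θ(Π)` -/

namespace EtaleThetaData

variable {S : ThetaSetting.{u}} {P : TopGroup.{u}} (D : EtaleThetaData S P)

/-- An additive automorphism of `H¹(Π_Ÿ(Π), (l·Δ_Θ)(Π))` moving every member of the orbit `η̈^{Θ,l·ℤ×μ_2}` to an orbit
member UP TO an `l`-torsion class maps `θ(Π)` into itself (`θ(Π) = {b | ∃ o ∈ orbit, l•(b+o) = 0}`, `theta_eq`).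
[claim: Mochizuki2012, status: disputed] (IUTchII §1 Prop 1.4, kurims p.27) -/
theorem image_theta_subset_of_orbit_torsion (ρ : D.coh.H1 ⊤ ≃+ D.coh.H1 ⊤)
    (horbit : ∀ o ∈ D.orbit, ∃ o' ∈ D.orbit, (S.l : ℕ) • (ρ o - o') = 0) : ρ '' D.theta ⊆ D.theta := by
  rintro _ ⟨b, hb, rfl⟩
  rw [D.theta_eq] at hb ⊢
  obtain ⟨o, ho, hlo⟩ := hb
  obtain ⟨o', ho', htor⟩ := horbit o ho
  refine ⟨o', ho', ?_⟩
  have h1 : ρ b + o' = ρ (b + o) - (ρ o - o') := by rw [map_add]; abel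
  rw [h1, smul_sub, ← map_nsmul, hlo, map_zero, htor, sub_zero]

/-- Two-sided version: if `ρ` and `ρ⁻¹` both move the orbit into «orbit + `l`-torsion», then `ρ '' θ(Π) = θ(Π)`.
[claim: Mochizuki2012, status: disputed] (IUTchII §1 Prop 1.4, kurims p.27) -/
theorem image_theta_eq_of_orbit_torsion (ρ : D.coh.H1 ⊤ ≃+ D.coh.H1 ⊤)
    (horbit : ∀ o ∈ D.orbit, ∃ o' ∈ D.orbit, (S.l : ℕ) • (ρ o - o') = 0)
    (horbit' : ∀ o ∈ D.orbit, ∃ o' ∈ D.orbit, (S.l : ℕ) • (ρ.symm o - o') = 0) : ρ '' D.theta = D.theta := by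
  refine Set.Subset.antisymm (D.image_theta_subset_of_orbit_torsion ρ horbit) fun t ht => ?_
  exact ⟨ρ.symm t, D.image_theta_subset_of_orbit_torsion ρ.symm horbit' ⟨t, ht, rfl⟩, by simp⟩

end EtaleThetaData

/-! ### 2. At the genuine data `Π = Π^tp_X̲̲` -/

namespace EtaleThetaDataOfSetting

variable {p : ℕ} [Fact p.Prime] {D : Literature.AnabelianGeometry.EtaleTheta.ThetaSetting p}
  {E : D.EtaleThetaData} {l : ℕ} (C : E.DoubleUnderline l) [(PiYdd C).Normal] (hq : IsQuotientMap D.toTheta)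
  {N : ℕ+} (μ : D.CyclotomeMod l N) (hC : D.Compat) (hS : D.Sec2Hyps) (h15 : D.Prop15iii E hC) (L : C.CuspLabels)
  (R : RigidData.{0} N l) (hR : R = C.rigidData μ hC hS h15 L) (h218i : R.Cor218_i)

/-- **The class `η̲̈^Θ` of the chosen `l`-th root in `H1 ⊤`** (abc-iut-L6-t1 / w4-d013's `rootLiftClass`, read through
`h1Top`; the one-root orbit `orbitOne` is `{conj_σ η̲̈^Θ | σ ∈ Π^tp_X̲̲}`). [cite: MochizukiEtTh2009, Def 2.7 p.41] -/
abbrev rootTop : (coh C).H1 ⊤ := (h1Top C).symm (Additive.ofMul (rootLiftClass C))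

/-- Members of the one-root orbit are the conjugates `conj_σ η̲̈^Θ` (abc-iut-w4-d043's `h1TopConjEquiv_symm_apply`).
[cite: Mochizuki2012, Prop 1.4 p.27] -/
theorem h1TopConjEquiv_rootTop (σ : Pi C) :
    h1TopConjEquiv (phi C) (D.lDeltaTheta l) (PiYdd C) σ (rootTop C) =
      (h1Top C).symm (Additive.ofMul (ContH1.conj (phi C) (D.lDeltaTheta l) σ (rootLiftClass C))) :=
  h1TopConjEquiv_symm_apply (phi C) (D.lDeltaTheta l) (PiYdd C) σ (Additive.ofMul (rootLiftClass C))

/-- `orbitOne = {conj_σ η̲̈^Θ}`: membership in the one-root orbit, `h1TopConjEquiv` form. [cite: Mochizuki2012, Prop 1.4 p.27] -/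
theorem mem_orbitOne_iff (y : (coh C).H1 ⊤) :
    y ∈ orbitOne C hC ↔ ∃ σ : Pi C, y = h1TopConjEquiv (phi C) (D.lDeltaTheta l) (PiYdd C) σ (rootTop C) := by
  constructor
  · rintro ⟨σ, rfl⟩
    exact ⟨σ, (h1TopConjEquiv_rootTop C σ).symm⟩
  · rintro ⟨σ, rfl⟩
    exact ⟨σ, h1TopConjEquiv_rootTop C σ⟩

section RootHyp

variable (hroot : ∀ α : (Pi C) ≃ₜ* (Pi C), ∃ τ : Pi C, ∃ ε : (coh C).H1 ⊤, l • ε = 0 ∧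
    autActTopOfCor218i C hq μ hC hS h15 L R hR h218i α (rootTop C) =
      h1TopConjEquiv (phi C) (D.lDeltaTheta l) (PiYdd C) τ (rootTop C) + ε)

include hroot in
/-- Under `hroot`, EVERY `ρ^⊤_α` moves the one-root orbit into «orbit + `l`-torsion»:
`ρ^⊤_α (conj_σ η̲̈) = conj_{α σ} (ρ^⊤_α η̲̈) = conj_{(α σ)·τ} η̲̈ + conj_{α σ} ε`. [cite: MochizukiEtTh2009, Cor 2.19 (iii) p.65] -/
theorem orbitOne_torsion_of_rootHyp (α : (Pi C) ≃ₜ* (Pi C)) (o : (coh C).H1 ⊤) (ho : o ∈ orbitOne C hC) :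
    ∃ o' ∈ orbitOne C hC, l • (autActTopOfCor218i C hq μ hC hS h15 L R hR h218i α o - o') = 0 := by
  obtain ⟨σ, rfl⟩ := (mem_orbitOne_iff C hC o).mp ho
  obtain ⟨τ, ε, hε, hατ⟩ := hroot α
  refine ⟨h1TopConjEquiv (phi C) (D.lDeltaTheta l) (PiYdd C) (α σ * τ) (rootTop C),
    (mem_orbitOne_iff C hC _).mpr ⟨α σ * τ, rfl⟩, ?_⟩
  rw [autActTopOfCor218i_h1TopConjEquiv, hατ, map_add, h1TopConjEquiv_mul_apply, add_sub_cancel_left,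
    ← map_nsmul, hε, map_zero]

include hroot in
/-- The same for the INVERSE of `ρ^⊤_α` (which is `ρ^⊤_{α⁻¹}`, `autActTopOfCor218i_symm_apply`).
[cite: MochizukiEtTh2009, Cor 2.19 (iii) p.65] -/
theorem orbitOne_torsion_symm_of_rootHyp (α : (Pi C) ≃ₜ* (Pi C)) (o : (coh C).H1 ⊤) (ho : o ∈ orbitOne C hC) :
    ∃ o' ∈ orbitOne C hC, l • ((autActTopOfCor218i C hq μ hC hS h15 L R hR h218i α).symm o - o') = 0 := by
  rw [autActTopOfCor218i_symm_apply]
  exact orbitOne_torsion_of_rootHyp C hq μ hC hS h15 L R hR h218i hroot α.symm o ho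

include hroot in
/-- **`ρ^⊤_α '' θ(Π) = θ(Π)`** for every `α`, under `hroot` (applied to `α` and to `α⁻¹`, whose action inverts that of
`α`). [cite: Mochizuki2012, Prop 1.4 p.27] -/
theorem image_autActTop_theta_of_rootHyp (hchar : PiYddCharacteristic C) (S : ThetaSetting.{0})
    (eS : (Pi C) ≃ₜ* S.PiX) (hl : S.l = l) (α : (Pi C) ≃ₜ* (Pi C)) :
    autActTopOfCor218i C hq μ hC hS h15 L R hR h218i α '' (etaleThetaDataOfSetting' C hC hS hchar S eS hl).theta =
      (etaleThetaDataOfSetting' C hC hS hchar S eS hl).theta := by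
  refine (etaleThetaDataOfSetting' C hC hS hchar S eS hl).image_theta_eq_of_orbit_torsion _ ?_ ?_
  · intro o ho
    obtain ⟨o', ho', h⟩ := orbitOne_torsion_of_rootHyp C hq μ hC hS h15 L R hR h218i hroot α o ho
    exact ⟨o', ho', by rw [hl]; exact h⟩
  · intro o ho
    obtain ⟨o', ho', h⟩ := orbitOne_torsion_symm_of_rootHyp C hq μ hC hS h15 L R hR h218i hroot α o ho
    exact ⟨o', ho', by rw [hl]; exact h⟩

include hroot in
/-- **(P4), `θ`-part: `ρ_α '' (toLim ⊤ '' θ(Π)) = toLim ⊤ '' θ(Π)`** for every `α`, under `hroot` (compatibility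
`toLim ⊤ ∘ ρ^⊤_α = ρ_α ∘ toLim ⊤` + abc-iut-w4-d030's `image_toLim_theta_eq_of_compat`). [cite: Mochizuki2012, Prop 1.4 p.27] -/
theorem image_autActOfCor218i_toLim_theta_of_rootHyp (hchar : PiYddCharacteristic C) (S : ThetaSetting.{0})
    (eS : (Pi C) ≃ₜ* S.PiX) (hl : S.l = l) (α : (Pi C) ≃ₜ* (Pi C)) :
    autActOfCor218i C hq μ hC hS h15 L R hR h218i α ''
        ((coh C).toLim ⊤ '' (etaleThetaDataOfSetting' C hC hS hchar S eS hl).theta) =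
      (coh C).toLim ⊤ '' (etaleThetaDataOfSetting' C hC hS hchar S eS hl).theta :=
  (etaleThetaDataOfSetting' C hC hS hchar S eS hl).image_toLim_theta_eq_of_compat
    (autActTopOfCor218i C hq μ hC hS h15 L R hR h218i α) (autActOfCor218i C hq μ hC hS h15 L R hR h218i α)
    (toLim_autActTopOfCor218i C hq μ hC hS h15 L R hR h218i α)
    (image_autActTop_theta_of_rootHyp C hq μ hC hS h15 L R hR h218i hroot hchar S eS hl α)

include hroot in
/-- **(P4), `∞θ`-part: `ρ_α '' ∞θ(Π) = ∞θ(Π)`** for every `α`, under `hroot` (abc-iut-w4-d030's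
`image_thetaInfty_eq_of_compat`). [cite: Mochizuki2012, Prop 1.4 p.27] -/
theorem image_autActOfCor218i_thetaInfty_of_rootHyp (hchar : PiYddCharacteristic C) (S : ThetaSetting.{0})
    (eS : (Pi C) ≃ₜ* S.PiX) (hl : S.l = l) (α : (Pi C) ≃ₜ* (Pi C)) :
    autActOfCor218i C hq μ hC hS h15 L R hR h218i α '' (etaleThetaDataOfSetting' C hC hS hchar S eS hl).thetaInfty =
      (etaleThetaDataOfSetting' C hC hS hchar S eS hl).thetaInfty :=
  (etaleThetaDataOfSetting' C hC hS hchar S eS hl).image_thetaInfty_eq_of_compat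
    (autActTopOfCor218i C hq μ hC hS h15 L R hR h218i α) (autActOfCor218i C hq μ hC hS h15 L R hR h218i α)
    (toLim_autActTopOfCor218i C hq μ hC hS h15 L R hR h218i α)
    (image_autActTop_theta_of_rootHyp C hq μ hC hS h15 L R hR h218i hroot hchar S eS hl α)

end RootHyp

end EtaleThetaDataOfSetting

end Literature.IUT.HodgeArakelov

end
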